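import Summits.Langlands.Langlands.Theorems.PicardMuOrdinaryMuOrdinaryFamilyRTThorneTwistData
import Summits.Langlands.Langlands.Theorems.PicardMuOrdinaryMuOrdinaryFamilyRTThorneCompanionAutReduction
import Summits.Langlands.Langlands.Theorems.PicardMuOrdinaryMuOrdinaryFamilyRTThorneCyclotomicModThree
import Summits.Langlands.Langlands.Theorems.PicardMuOrdinaryMuOrdinaryFamilyRTThorneCMTypePlaces
import Summits.Langlands.Langlands.Theorems.PicardMuOrdinaryMuOrdinaryFamilyRTThorneCompanionLevelMono
import Literature.NumberTheory.GaloisRepresentations.CMCharacterCyclotomicSquareRoot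
import HarnessLib

/-!
# Crux `MuOrdinaryFamilyRT` (stmt-Langlands-13757), line `thorne-minimal-lift`: the kernel-checked reductions of
# skeleton v7 — the twisting character chosen ONCE per auxiliary field and the level enlarged (Reduction file of
# `…ThorneTwistData`, p166345)

Proofs only.  `stub_companionsS_of : MF1ᵃ → MF2 → G1 → T.stub_companionsS` (as `stub_companionsT_of`, exporting `ThreeSplitFromMaximalReal F'`);
`under_mem_of_three_mem`; `definiteHostPlusTw_of : (CHT 4.1.6 fact) → T.stub_finiteOverWeights → T.stub_companionsS → T.stub_thorneLiftTw →
T.stub_definiteHostPlusW` — the LEVEL-ENLARGING reduction: `θ` from the Literature fact `ClozelHarrisTaylor2008.exists_cm_character_sq_eq_cyclotomic_pow`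
(p166049) with `k = -2-m`, `θ̄ = 1` admissible by the landed `toZMod_cyclotomicCharacter_zpow_eq_one` (p167030), the CM type of places above `3` by
`exists_cmType_places_three` (p167396); the level `S'` is enlarged by the finitely many places away from `3` where `θ` ramifies (`Filter.eventually_cofinite`),
companions persist by `hasThorneCompanion_mono` (p167515), and `TwistData 𝓕.m F' S'' θ` is assembled; `MuOrdinaryFamilyRT_of_thorneStubsTw` (the crux BY NAME from
the six v7 stubs and the fact) and `rtMuOrdinaryMinimal_of_thorneStubsTw` (child A).  `stub_companionsS_of` and `MuOrdinaryFamilyRT_of_thorneStubsTw` are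
registered on the crux item.
-/

set_option linter.dupNamespace false

namespace Summit.Langlands.Langlands.Cruxes.MuOrdinaryFamilyRT.ThorneMinimalLift

open scoped NumberField Polynomial Matrix Classical
open Field IsDedekindDomain Polynomial Filter
open Literature.NumberTheory.GaloisRepresentations Literature.NumberTheory.Automorphic
open Summit.Langlands.Langlands.Cruxes.MuOrdinaryFamilyRT.CharZeroDominance

noncomputable section

variable {f : ℤ[X]} {ι : PadicAlgCl 3 ≃+* ℂ} {e : K →+* ℂ} {S₀ : Finset (HeightOneSpectrum (𝓞 K))}
  {ρC : FramedGaloisRep K (PadicAlgCl 3) 3}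

/-- **`T.stub_companionsS` from MF1ᵃ + MF2 + G1** (as `stub_companionsT_of`, exporting `ThreeSplitFromMaximalReal F'` from G1). -/
theorem stub_companionsS_of : Missing.hidaOrdinaryCompanionsAut → Missing.ordinaryPolarizedSeed → Missing.auxiliaryCMField → T.stub_companionsS := by
  intro hMF1 hMF2 hG1 f ι e S₀ ρC 𝓕 hgen hin hM hdim hpur hfin hW
  obtain ⟨F', iF, iN, iA, iG, iCM, hdeg, hrange, hunr, hsplit⟩ := hG1 f ι e S₀ ρC 𝓕 hgen hin hM
  have hcpt' : isCompact_glFiniteIntegralLevel 3 F' := isCompact_glFiniteIntegralLevel_holds 3 F'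
  obtain ⟨D, E, hE, hint, hacc, hpts⟩ :=
    arithmeticPoints_of_weightDataOver 𝓕 hfin F' (hW F' hdeg hsplit)
  obtain ⟨S', P₀, r₀, hS', hP₀, hirr, hcompat₀, hunr₀, hpol₀, hpur₀, haux₀, hred₀, hord₀⟩ :=
    hMF2 f ι e S₀ ρC 𝓕 hgen hin hM hpur F' hcpt' hdeg hrange hunr hsplit
  refine ⟨F', iF, iN, iA, iG, hcpt', S', D, E, iCM, hdeg, hsplit, hrange, hE, hS', hint, hacc, ?_⟩
  intro y hy
  obtain ⟨hcont, hyint, hpolar, wt, hwt⟩ := hpts y hy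
  have hdom : ∀ w : HeightOneSpectrum (𝓞 F'), ((3 : ℕ) : 𝓞 F') ∈ w.asIdeal → (wt w).IsDominant :=
    fun w hw => isDominant_of_gaps (wt w) (hwt w hw).1
  have hwit : ∃ ρ : absoluteGaloisGroup F' →* GL (Fin 3) (PadicAlgCl 3), TracePolarizedHom F' 𝓕.m ρ ∧
      ∀ w : HeightOneSpectrum (𝓞 F'), ((3 : ℕ) : 𝓞 F') ∈ w.asIdeal →
        ∀ art : LocalArtinData (w.adicCompletion F'), art.IsCanonical →
          IsBorelOfWeightAt F' w art ρ (wt w) :=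
    ⟨_, hpolar, fun w hw art hart => (hwt w hw).2 art hart⟩
  obtain ⟨P, r, hP, hcompat, hunrr, hpol, hpurr, ⟨g, hcong⟩, hord, haut⟩ :=
    hMF1 F' ι hcpt' S' 𝓕.m hunr hsplit P₀ r₀ hP₀ hirr hcompat₀ hunr₀ hpol₀ hpur₀ haux₀
      (fun σ i j => (hred₀ σ i j).1) hord₀ wt hdom hwit
  refine ⟨P, r, hP, hcompat, hpol, hpurr, hcont, hyint, ⟨g, fun σ i j => ⟨(hcong σ i j).1, ?_⟩⟩, ?_, hunrr, haut⟩
  · exact norm_sub_lt_one_chain₃ _ _ _ _ (hcong σ i j).2 (hred₀ σ i j).2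
      (norm_cast_rbar_sub_pointRep_lt_one 𝓕 y hcont (absGaloisRestrict K F' σ) i j)
  · intro w hw art hart
    refine ⟨wt w, (hwt w hw).1, hord w hw art hart, ?_⟩
    obtain ⟨g', U, hup, hdiag⟩ := (hwt w hw).2 art hart
    exact ⟨g', U, hup, hdiag⟩

/-- A place of `F'` above `3` lies over a place of `K` above `3`, hence (by `PicardInput`) over `S₀`. -/
theorem under_mem_of_three_mem (hin : PicardInput f ι e S₀ ρC) {F' : Type} [Field F'] [NumberField F'] [Algebra K F']
    (w : HeightOneSpectrum (𝓞 F')) (hw : ((3 : ℕ) : 𝓞 F') ∈ w.asIdeal) : w.under (𝓞 K) ∈ S₀ := by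
  refine hin.1 _ ?_
  change ((3 : ℕ) : 𝓞 K) ∈ Ideal.comap (algebraMap (𝓞 K) (𝓞 F')) w.asIdeal
  rw [Ideal.mem_comap, map_natCast]
  exact hw

/-- **K1⁺ (relativised) from finiteness, split companions, lifting-with-twist and the CHT 4.1.6 fact** —
the LEVEL-ENLARGING reduction of v7: the twisting character `θ` is chosen ONCE per auxiliary field by CHT Lemma 4.1.6 (Literature fact,
hypothesis `hF2`; `θ̄ = 1` is admissible by the landed `toZMod_cyclotomicCharacter_zpow_eq_one` p167030: `ε^{-2-m}` is residually trivial on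
`Γ_{F'}`, `ζ₃ ∈ K ⊆ F'`; the CM type `Φ` of places above `3` exists by the landed `exists_cmType_places_three` p167396 since every place above
`3` is split over `F'⁺`), the level `S'` is enlarged by the finitely many places away from `3` where `θ` ramifies (companions persist: landed
`hasThorneCompanion_mono` p167515, monotonicity of `HasThorneCompanion` in the level through clause (f)), and the lifting stub is applied at
the enlarged level with the twist datum. -/
theorem definiteHostPlusTw_of (hF2 : ClozelHarrisTaylor2008.exists_cm_character_sq_eq_cyclotomic_pow) :
    T.stub_finiteOverWeights → T.stub_companionsS → T.stub_thorneLiftTw → T.stub_definiteHostPlusW := by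
  intro hfin hcomp hlift f ι e S₀ ρC 𝓕 hgen hin hM hdim hpur hΛ hW
  have hfin' : Module.Finite 𝓕.Λ 𝓕.R := hfin f ι e S₀ ρC 𝓕 hgen hin hM hdim hpur hΛ
  refine ⟨hfin', ?_⟩
  obtain ⟨F', instF, instNF, instA, instG, hcpt', S', D, E, instCM, hdeg, hsplit, hrange, hE, hS', hDint, hDacc, hcompanion⟩ :=
    hcomp f ι e S₀ ρC 𝓕 hgen hin hM hdim hpur hfin' hW
  -- the CM type and the twisting character, chosen once
  obtain ⟨Φ, hΦ3, hΦc⟩ := exists_cmType_places_three F' hsplit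
  have h23 : 2 < 3 := by norm_num
  obtain ⟨θ, hθ1, hθ2, hθ3, hθ4, hθ5, hθ6⟩ := hF2 F' 3 h23 (-2 - 𝓕.m) (toZMod_cyclotomicCharacter_zpow_eq_one F' 𝓕.m) Φ hΦ3 hΦc
  -- the finitely many places away from `3` where `θ` ramifies
  have hTfin : {v : HeightOneSpectrum (𝓞 F') |
      ¬ ∀ τ ∈ absInertia (v.adicCompletion F'), θ (absGaloisRestrict F' (v.adicCompletion F') τ) = 1}.Finite :=
    Filter.eventually_cofinite.mp hθ5
  set S'' : Finset (HeightOneSpectrum (𝓞 F')) :=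
    S' ∪ (hTfin.toFinset.filter fun v => ((3 : ℕ) : 𝓞 F') ∉ v.asIdeal) with hS''def
  have hsub : S' ⊆ S'' := Finset.subset_union_left
  have hnew : ∀ w ∈ S'', w ∉ S' → ((3 : ℕ) : 𝓞 F') ∉ w.asIdeal := by
    intro w hw hw'
    rcases Finset.mem_union.mp hw with h | h
    · exact absurd h hw'
    · exact (Finset.mem_filter.mp h).2
  -- the twist datum at the enlarged level
  have hTw : TwistData 𝓕.m F' S'' θ := by
    refine ⟨hθ1, hθ2, fun w hw => ?_, fun w h3 hwS τ hτ => ?_, fun w _ h3 => hθ6 w h3⟩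
    · by_cases hwΦ : w ∈ Φ
      · exact ⟨-2 - 𝓕.m, Or.inl rfl, hθ3 w hwΦ⟩
      · refine ⟨0, Or.inr rfl, fun τ hτ => ?_⟩
        rw [hθ4 w hw hwΦ τ hτ, zpow_zero, Units.val_one, Units.val_one, map_one]
    · by_contra hne
      apply hwS
      refine Finset.mem_union_right _ (Finset.mem_filter.mpr ⟨hTfin.mem_toFinset.mpr ?_, h3⟩)
      exact fun hall => hne (hall τ hτ)
  refine ⟨F', instF, instNF, instA, hcpt', S'', D, E, hdeg, hE, fun w hw => hsub (hS' w hw), hDint, hDacc, fun y hy => ?_⟩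
  exact hlift f ι e S₀ ρC 𝓕 hgen hin hM hpur F' hcpt' S'' hdeg hsplit hrange (fun w hw => hsub (hS' w hw)) θ hTw y
    (hasThorneCompanion_mono f ι e S₀ ρC 𝓕 F' hcpt' S' S'' y hsub hnew (hcompanion y hy))

/-- **The crux from the six v7 stubs + the CHT 4.1.6 fact** (through the landed `MuOrdinaryFamilyRT_of_plusW`). -/
theorem MuOrdinaryFamilyRT_of_thorneStubsTw : ClozelHarrisTaylor2008.exists_cm_character_sq_eq_cyclotomic_pow → T.stub_minimalFamilyW → T.stub_finiteOverWeights → T.stub_companionsS → T.stub_thorneLiftTw → T.stub_remainderPlus → T.stub_facts → Summit.Langlands.Langlands.Theses.PicardMuOrdinary.MuOrdinaryFamilyRT :=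
  fun hF2 h₁ h₂ h₃ h₄ h₅ h₆ =>
    crux_iff.mpr <|
      MuOrdinaryFamilyRT_of_plusW (stub_picardInput_of h₆.1) h₁ (definiteHostPlusTw_of hF2 h₂ h₃ h₄) stub_accumulation
        (stub_quadraticDescent_of h₆.2.1 h₆.2.2.1
          Literature.NumberTheory.Automorphic.exists_twist_quadraticSign_holds
          h₆.2.2.2.1 h₆.2.2.2.2.1 h₆.2.2.2.2.2)
        stub_dictionary h₅

/-- **Child A of the landed Split from the v7 stubs + the CHT 4.1.6 fact** (through `rtMuOrdinaryMinimal_of_plusW`). -/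
theorem rtMuOrdinaryMinimal_of_thorneStubsTw : ClozelHarrisTaylor2008.exists_cm_character_sq_eq_cyclotomic_pow → T.stub_minimalFamilyW → T.stub_finiteOverWeights → T.stub_companionsS → T.stub_thorneLiftTw → S.stub_descentFacts → Summit.Langlands.Langlands.Cruxes.MuOrdinaryFamilyRT.Split.RTMuOrdinaryMinimal :=
  fun hF2 h₁ h₂ h₃ h₄ h₆ =>
    rtMuOrdinaryMinimal_of_plusW h₁ (definiteHostPlusTw_of hF2 h₂ h₃ h₄)
      (stub_quadraticDescent_of h₆.1 h₆.2.1 Literature.NumberTheory.Automorphic.exists_twist_quadraticSign_holds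
        h₆.2.2.1 h₆.2.2.2.1 h₆.2.2.2.2)

end

end Summit.Langlands.Langlands.Cruxes.MuOrdinaryFamilyRT.ThorneMinimalLift
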